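import Summits.CriticalPhenomena.PercolationContinuityZ3.Theorems.Transplant.PlanarSkeletonFrmFromDefs
import Summits.CriticalPhenomena.PercolationContinuityZ3.Theorems.Transplant.SkelFrmFromBChoiceDefs3
import Summits.CriticalPhenomena.PercolationContinuityZ3.Theorems.Transplant.SkelFrmBChoiceDefs3
import Summits.CriticalPhenomena.PercolationContinuityZ3.Theorems.Transplant.SkelPhiCellsFineGeomS
import Summits.CriticalPhenomena.PercolationContinuityZ3.Theorems.Transplant.SkelNeg1ChoiceAll
import HarnessLib
import Summits.CriticalPhenomena.PercolationContinuityZ3.Theorems.Transplant.SkelFrmBChoiceGeom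
/-!
# U-WAVE PORT (RULING D-U, lead g21 2026-08-26; WAVE-U-MANIFEST v3.0 row «SkelFrmBChoiceGeom» ↦ «SkelFrmFromBChoiceGeom») of the tree module
# `Transplant/SkelFrmBChoiceGeom` onto the carrier `PlanarSkeletonFrmFrom` (frames only, cylinders connected from width `ℓ₀` on)

ORIGINAL TITLE: N2 (frames-only node `SamePDropOfSkeletonFrmFrom₁`, OPEN), WAVE 1: THE GEOMETRIC OBLIGATION OF THE CHOICE FUNCTION OF RECORD —

builds on p205010 (kernel theorem, internal audit signed; external expert review pending) — nothing in this file uses p205010; NOTHING is claimed about the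
OPEN node U `SamePDropOfSkeletonFrmFrom₁` (nor U_s / the end state).  Lane `prim-bschramm`, seat `prim-bschramm-p3` gen 26; helper file
(`--supports stmt-CriticalPhenomena-4575 --as helper`).  PORT RULES r1–r4 of RULING D-U: declaration order and proof texts are those of the original,
byte-identical except (i) the carrier token `PlanarSkeletonFrm ↦ PlanarSkeletonFrmFrom` (binders, `namespace`/`end` lines, qualified names of twinned
declarations), (ii) carrier-FREE declarations of the original (φ-level `Skelφ…` blocks and namespace-only arithmetic residents) are NOT re-declared —
this file imports the original and `export`s the twin-free residents (POLICY T / treatment (m1)); residents whose statement mentions a twinned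
constant are copied, (iii) every carrier-binding declaration keeps its explicit binder `(Φ : PlanarSkeletonFrmFrom G)` in its own signature (r2).  Docstrings and citations are the original's.
-/

noncomputable section

open scoped Classical

namespace Summit.CriticalPhenomena.PercolationContinuityZ3.Theorems.Transplant

open MeasureTheory Literature.Probability.Percolation Literature.Probability.LatticeModels SimpleGraph KNCells
open Literature.Barriers.CriticalPhenomena (HasExponentialGrowth graphBall)

namespace PlanarSkeletonFrmFrom

open SkelConc (Consts)
open BoxProdZ2 (ConcRadiiG)
open Skelφ (oriφ trφ)
open Skelφ.StepI (DataN DataNS OutNS)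

namespace NegB

open Neg

section Geom

variable (κ : Consts) {V : Type} [DecidableEq V] [Countable V] {G : SimpleGraph V} [G.LocallyFinite] (Φ : PlanarSkeletonFrmFrom G) (t : V)
  (p : unitInterval) (D : DataNS V) (g f : ℕ) (c : Fin 2 → ℕ)

/-! ## §1 The column point over the staggered centre -/

/-- **THE COLUMN POINT over the STAGGERED centre** for the fine map of the (ζ′) chain: for every cube `Q x` of the staggered cells `fcellsS … c` and every radius
`R ≥ NrepA (cenS x) + 1`, a vertex of fine position exactly `cenS x` inside the window span `VWin (Q x) R`. [cite: KozmaNitzan2024, §4 p. 26 ((29): columns)] -/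
theorem hcol_fineA_atS (κ : Consts) {V : Type} [DecidableEq V] [Countable V] {G : SimpleGraph V} [G.LocallyFinite] (Φ : PlanarSkeletonFrmFrom G) (t : V) (p : unitInterval) (D : DataNS V) (g : ℕ) (f : ℕ) (c : Fin 2 → ℕ) {φ' : V → Site 2} (hlip : Skelφ.Lip G φ') (hstep : Skelφ.Steps G φ') (hN : EqNumL κ Φ t p D g f) (x : Site 2) {R : ℕ}
    (hR : NrepA κ Φ t p D g f ((fcellsS κ Φ t p D g f c).cenS x) + 1 ≤ R) :
    ∃ y ∈ Skelφ.VWin G (fineA κ Φ t p D g f φ') t ((fcellsS κ Φ t p D g f c).Q x) R, fineA κ Φ t p D g f φ' y = (fcellsS κ Φ t p D g f c).cenS x := by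
  obtain ⟨hn1, hℓ1⟩ := one_le_of_eqNumL κ Φ t p D g f hN
  obtain ⟨r0, r1⟩ := room_fcellsA_at κ Φ t p D g f hN
  have hD := Skelφ.NegPrm.DofA_pos (Aof_pos κ).2 hn1 hℓ1 (hL κ Φ t p D g f) (vL κ Φ t p D g f)
  exact Skelφ.hcol_fineSkelS (A := Aof κ) (n := (nL κ Φ t p D g f : ℤ)) (h := hL κ Φ t p D g f) (vα := vL κ Φ t p D g f) (vβ := vβL κ Φ t p D g f) hlip hstep t
    (cA_pos κ Φ t p D g f 0) (cA_pos κ Φ t p D g f 1) hD r0 r1 (fcellsS κ Φ t p D g f c) x hR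

/-- **`hcol` in the shape `sepGeomSG₂S` consumes**, from a schedule whose cube radii dominate the column radius at the staggered centres. [folklore] -/
theorem hcol_fineA_of_schedS (κ : Consts) {V : Type} [DecidableEq V] [Countable V] {G : SimpleGraph V} [G.LocallyFinite] (Φ : PlanarSkeletonFrmFrom G) (t : V) (p : unitInterval) (D : DataNS V) (g : ℕ) (f : ℕ) (c : Fin 2 → ℕ) {φ' : V → Site 2} (hlip : Skelφ.Lip G φ') (hstep : Skelφ.Steps G φ') (hN : EqNumL κ Φ t p D g f) {Λ : ConcRadiiG}
    (hcolQ : ∀ a x, NrepA κ Φ t p D g f ((fcellsS κ Φ t p D g f c).cenS x) + 1 ≤ Λ.rQ a x) :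
    ∀ a x, ∃ y ∈ Skelφ.VWin G (fineA κ Φ t p D g f φ') t ((fcellsS κ Φ t p D g f c).Q x) (Λ.rQ a x),
      fineA κ Φ t p D g f φ' y = (fcellsS κ Φ t p D g f c).cenS x :=
  fun a x => hcol_fineA_atS κ Φ t p D g f c hlip hstep hN x (hcolQ a x)

/-! ## §2 The nine conjuncts for the staggered cells with small boxes -/

/-- **THE NINE `GeomHoldsN` CONJUNCTS FOR THE STAGGERED CELLS WITH SMALL BOXES, map slot `φ′`** (`cellGeomSG₂bS … b₀` for any `b₀ ≤ 3r`, any creep value `c`).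
[cite: KozmaNitzan2024, §4 pp. 25–29] -/
theorem geom_fineA_at_bS (κ : Consts) {V : Type} [DecidableEq V] [Countable V] {G : SimpleGraph V} [G.LocallyFinite] (Φ : PlanarSkeletonFrmFrom G) (t : V) (p : unitInterval) (D : DataNS V) (g : ℕ) (f : ℕ) (c : Fin 2 → ℕ) {φ' : V → Site 2} (hlip : Skelφ.Lip G φ') (hstep : Skelφ.Steps G φ') (hN : EqNumL κ Φ t p D g f) {Λ : ConcRadiiG}
    (hΛ : Skelφ.WFS2 (fcellsS κ Φ t p D g f c).toPCells2 Λ) (hcolQ : ∀ a x, NrepA κ Φ t p D g f ((fcellsS κ Φ t p D g f c).cenS x) + 1 ≤ Λ.rQ a x)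
    {b₀ : Fin 2 → ℕ} (hb : ∀ i, b₀ i ≤ 3 * (fcellsS κ Φ t p D g f c).r i) :
    (Skelφ.cellGeomSG₂bS G (fineA κ Φ t p D g f φ') (fcellsS κ Φ t p D g f c) t Λ b₀).root = t ∧
      κ.K₀ ≤ (Skelφ.cellGeomSG₂bS G (fineA κ Φ t p D g f φ') (fcellsS κ Φ t p D g f c) t Λ b₀).K ∧
      Skelφ.Lip G (fineA κ Φ t p D g f φ') ∧
      RunGeom G (Skelφ.cellGeomSG₂bS G (fineA κ Φ t p D g f φ') (fcellsS κ Φ t p D g f c) t Λ b₀) ∧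
      AnchGeom (Skelφ.cellGeomSG₂bS G (fineA κ Φ t p D g f φ') (fcellsS κ Φ t p D g f c) t Λ b₀) ∧
      SepGeom₂ G (Skelφ.cellGeomSG₂bS G (fineA κ Φ t p D g f φ') (fcellsS κ Φ t p D g f c) t Λ b₀) ∧
      ExitGeom G (Skelφ.cellGeomSG₂bS G (fineA κ Φ t p D g f φ') (fcellsS κ Φ t p D g f c) t Λ b₀) ∧
      StepsGeom (Skelφ.cellGeomSG₂bS G (fineA κ Φ t p D g f φ') (fcellsS κ Φ t p D g f c) t Λ b₀)
        (Skelφ.faceDataSGS G (fineA κ Φ t p D g f φ') (fcellsS κ Φ t p D g f c) t Λ) ∧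
      LevelGeom G (Skelφ.cellGeomSG₂bS G (fineA κ Φ t p D g f φ') (fcellsS κ Φ t p D g f c) t Λ b₀)
        (Skelφ.faceDataSGS G (fineA κ Φ t p D g f φ') (fcellsS κ Φ t p D g f c) t Λ)
        (Skelφ.levelDataSS (fineA κ Φ t p D g f φ') (fcellsS κ Φ t p D g f c)) := by
  have hψ0 := fineA_base_at κ Φ t p D g f φ' hN
  have hlipψ := lip_fineA_at κ Φ t p D g f hlip hN
  have hws := weakSteps_fineA_at κ Φ t p D g f hstep hN
  have hcol := hcol_fineA_of_schedS κ Φ t p D g f c hlip hstep hN hcolQ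
  refine ⟨rfl, (fcellsA_K κ Φ t p D g f).2.1, hlipψ, Skelφ.runGeomSG₂bS _ _ _, Skelφ.anchGeomSG₂bS _ _ _,
    Skelφ.sepGeom₂SG₂bS _ _ _ hΛ hψ0 hlipψ hws hcol, Skelφ.exitGeomSG₂bS _ _ _ hΛ hlipψ hb, Skelφ.stepsGeomSG₂bS _ _ _ hΛ hlipψ hws hb,
    Skelφ.levelGeomSG₂bS _ _ _ hΛ hlipψ hb⟩

end Geom

end NegB

/-! ## §3 The geometric obligation of the choice function of record -/

/-- **`GeomHoldsNQFn (frmChoiceAllQ3 gv fv Pv Sv cv bv)` FOR EVERY SLOT VALUE** (the N2 scheme over the staggered cells; `bOf ≤ 3r` by `bOf_le`, the column floor at the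
staggered centre by `colQ_schedOfS`, the long clause from `FactsNS`). [cite: KozmaNitzan2024, §4 pp. 25–29] -/
theorem geomHoldsNQFn_frmChoiceAllQ3 (gv fv : PlanarSkeletonFrmFrom.Neg.FSlot) (Pv : NegB.PSlot) (Sv : NegB.SSlot) (cv : NegB.CSlot) (bv : NegB.BSlot) :
    GeomHoldsNQFn (frmChoiceAllQ3 gv fv Pv Sv cv bv) := by
  intro κ V _ _ G _ Φ hg t ht h1 p hp0 hp1 hC O q hAt
  obtain ⟨-, -, hR, -, -⟩ := Skelφ.StepI.OutO.FactsO.shared hAt.1.factsO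
  obtain ⟨h1', h2, -, h4, h5, h6, h7, h8, h9⟩ := NegB.geom_fineA_at_bS κ Φ t p O.merged (NegB.gOf κ Φ t p O gv) (NegB.fOf κ Φ t p O fv)
    (NegB.cOf κ Φ t p O gv fv cv)
    (NegB.lip_φL κ Φ t p O.D O.DT.toDataN O.ori (NegB.gOf κ Φ t p O gv) (NegB.fOf κ Φ t p O fv))
    (NegB.steps_φL κ Φ t p O.D O.DT.toDataN O.ori (NegB.gOf κ Φ t p O gv) (NegB.fOf κ Φ t p O fv))
    (NegB.eqNumL_of_factsO κ Φ t p O.D O.DT.toDataN O.ori _ _ hR (Skelφ.StepI.OutO.FactsO.clauses hAt.1.factsO))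
    (NegB.schedOfS_WFS2 κ Φ t p O.merged (NegB.gOf κ Φ t p O gv) (NegB.fOf κ Φ t p O fv) (NegB.cOf κ Φ t p O gv fv cv)
      (Sv κ Φ t p O.merged (NegB.gOf κ Φ t p O gv) (NegB.fOf κ Φ t p O fv) q))
    (NegB.colQ_schedOfS κ Φ t p O.merged (NegB.gOf κ Φ t p O gv) (NegB.fOf κ Φ t p O fv) (NegB.cOf κ Φ t p O gv fv cv)
      (Sv κ Φ t p O.merged (NegB.gOf κ Φ t p O gv) (NegB.fOf κ Φ t p O fv) q))
    (NegB.bOf_le κ Φ t p O gv fv cv bv)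
  exact ⟨h1', h2, h4, h5, h6, h7, h8, h9⟩

end PlanarSkeletonFrmFrom

end Summit.CriticalPhenomena.PercolationContinuityZ3.Theorems.Transplant

end
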